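/-
Copyright: public-audit package `pub-balaban` (b2b-balaban), seat pv28-g13. Released under Apache 2.0 like Mathlib.
-/
import Literature.MathematicalPhysics.QuantumFieldTheory.Balaban1983to89.T4WilsonSmallFieldNumerics

/-!
# T4 — caveat (USE), items (USE-b) + (HYB): a CONCRETE staple deviation functional and the hybrid-field small field
# derived from the reference field's — the (γ) plug for the k = 0 Wilson exponent with field hypotheses on `u₀` only

* Value = kernel certificate (quaternion bookkeeping + one application of the parent plug BY NAME); NOT summit
  progress; NOT continuum; NOT Clay.  0 [cite], 0 [model]: everything here is [folklore]; NO printed sentence is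
  asserted and nothing internally minted is cited (ABSOLUTE RULE).  Cell row T4-O3.E-iii-b-G7 (BL-window), lineage
  pv28, record `t4/T4-EST-O3Eiiib-G7.md` §2decies–§2terdecies; this leaf types the items (USE-b) and (HYB) of GAPS
  G-pv28g13-4.
* WHAT IT ADDS to `T4WilsonSmallFieldNumerics` (whose corollary `mem_respDom_of_wilson_smallField_num` still asked for
  an ABSTRACT deviation functional `dev` with a budget binder `hgapN`, for δ-closeness of the LINKS of `u` and `u₀` on
  the staple bonds of `b`, and for a small field on the plaquettes through `b` of BOTH `u₀` and the hybrid field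
  `u with u(b) := u₀ b`):
  (1) THE STAPLE DEVIATION `stapleDist b u₀ u := Σ_{p ∋ b} ‖plaqDatum u b p − plaqDatum u₀ b p‖` — the sum over the
      `2(d−1)` plaquettes through `b` of the quaternion distance between the STAPLES (cofactors of the link) of `u`
      and of `u₀`; it is what the Wilson exponent through `b` actually sees of the exterior (`stapleDist_nonneg`,
      `norm_plaqDatum_sub_le_stapleDist`, `norm_wilsonDatum_sub_le_stapleDist : ‖a_u − a_{u₀}‖ ≤ |c·w|·stapleDist`,
      and `stapleDist_le_of_staple : stapleDist ≤ N_b·3δ` under staple δ-closeness of the links);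
  (2) (HYB) THE HYBRID FIELD'S PLAQUETTES FROM THE REFERENCE FIELD'S: for `b ∈ ∂p`,
      `|reTr((u with u(b) := u₀ b)(∂p)) − reTr(u₀(∂p))| ≤ ‖plaqDatum u b p − plaqDatum u₀ b p‖ ≤ stapleDist b u₀ u`
      (`abs_reTr_update_sub_reTr_le`, `reTr_update_ge_of_stapleDist`) — so the hypothesis `hsf₁` of the parent
      corollaries FOLLOWS from `hsf₀` at the price `ε ↦ ε + stapleDist b u₀ u`;
  (3) THE DATUM-CURRENCY COROLLARY `mem_respDom_of_wilson_smallField_datum` (budget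
      `β·w·stapleDist b u₀ u·(1+ρ+ρ²) ≤ bH·dev u`, no link closeness at all) and THE CONCRETE COROLLARY
      `mem_respDom_of_wilson_stapleDist`: the parent plug for `h = fun U => −β * wilsonAction w U` through `{b}` with
      `dev := stapleDist b u₀`, the EXPLICIT slope `β·w·(1+ρ+ρ²)/√λ`, `λ = gnoKappa S' + 7/25·(β·w·2(d−1))`, and whose
      ONLY field hypotheses are `reTr(u₀(∂p)) ≥ 1 − ε` on the `2(d−1)` plaquettes through `b` of the REFERENCE
      exterior and `ε + stapleDist b u₀ u ≤ 1/8` (plus `0 ≤ β`, `0 ≤ w`, `0 ≤ ε`, the window numbers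
      `0 < S < S' ≤ 1`, `0 ≤ ρ ≤ 1/4`, `n·S'² ≤ ρ²`, and the plug's measurability / integrability / insert binders).

## Honest caveats

* (USE) what is NOT proved here: that Bałaban's small-field region makes `reTr(u₀(∂p)) ≥ 1 − ε` with
  `ε + stapleDist ≤ 1/8` on the exteriors where the bound is consumed, UNIFORMLY in the step `k` (EST; B12 (0.18)
  pointer-only in the record), and that the consumer lineage (pv16, `T4CovarianceResponse`) adopts `stapleDist b u₀`
  (or anything dominating it) as its deviation functional with caps `dev ≤ d` on its live sets — consumer-side.  The
  thresholds `1/8`, `1/4`, `7/25` are inherited from `T4WilsonSmallFieldNumerics`, convenient not optimal.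
  (N1) one-link fibres; (RANK) `SU(2)`; (INS) the measurability / integrability / insert binders are the plug's;
  (k ≥ 1) k = 0 Wilson exponent only — Bałaban's effective actions after RG steps are not of this form.
-/

noncomputable section

open scoped Quaternion

namespace Literature.MathematicalPhysics.QuantumFieldTheory.Balaban1983to89.T4WilsonStapleDeviation

open Literature.MathematicalPhysics.QuantumLattice (su2Quat norm_su2Quat)
open Literature.Probability.Distributions (coordGradient)
open Function (updateFinset)
open T4CubePoincare (cube)
open T4CubeChartGnomonic (SU2 gnoFibreChart windowDensity)
open T4CubeConvexExtension (gnoKappa)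
open T4GnomonicWilsonHessian (gnoMu gnoMu_mono_left mem_respDom_of_gnoChart_linkAffine')
open T4WilsonLinkAffine
open T4WilsonDatumBounds
open T4WilsonSmallFieldNumerics

variable {P : Params} {j : ℕ} [DecidableEq (PBond P j)]

/-! ## §1  The staple deviation functional -/

/-- **THE STAPLE DEVIATION** of the exterior `u` from the reference `u₀` at the link `b`:
`Σ_{p ∋ b} ‖plaqDatum u b p − plaqDatum u₀ b p‖`, the total quaternion distance between the staples of `u` and of
`u₀` over the plaquettes through `b`. [folklore] -/
def stapleDist (b : PBond P j) (u₀ u : GaugeField P j SU2) : ℝ :=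
  ∑ p ∈ Finset.univ.filter (fun p : Plaq P j => IsLetter b p), ‖plaqDatum u b p - plaqDatum u₀ b p‖

/-- The staple deviation is non-negative. [folklore] -/
theorem stapleDist_nonneg (b : PBond P j) (u₀ u : GaugeField P j SU2) : 0 ≤ stapleDist b u₀ u :=
  Finset.sum_nonneg fun _ _ => norm_nonneg _

/-- The reference exterior has deviation `0`. [folklore] -/
theorem stapleDist_self (b : PBond P j) (u₀ : GaugeField P j SU2) : stapleDist b u₀ u₀ = 0 := by
  simp only [stapleDist, sub_self, norm_zero, Finset.sum_const_zero]

/-- Each staple distance is dominated by the staple deviation (for `b ∉ ∂p` both data vanish). [folklore] -/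
theorem norm_plaqDatum_sub_le_stapleDist (b : PBond P j) (u₀ u : GaugeField P j SU2) (p : Plaq P j) :
    ‖plaqDatum u b p - plaqDatum u₀ b p‖ ≤ stapleDist b u₀ u := by
  by_cases hL : IsLetter b p
  · exact Finset.single_le_sum (f := fun p : Plaq P j => ‖plaqDatum u b p - plaqDatum u₀ b p‖)
      (fun _ _ => norm_nonneg _) (Finset.mem_filter.2 ⟨Finset.mem_univ _, hL⟩)
  · rw [plaqDatum_of_not_isLetter hL, plaqDatum_of_not_isLetter hL, sub_zero, norm_zero]
    exact stapleDist_nonneg b u₀ u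

/-- The staple deviation as a sum over ALL plaquettes. [folklore] -/
theorem stapleDist_eq_sum_univ (b : PBond P j) (u₀ u : GaugeField P j SU2) :
    stapleDist b u₀ u = ∑ p : Plaq P j, ‖plaqDatum u b p - plaqDatum u₀ b p‖ := by
  unfold stapleDist
  refine Finset.sum_filter_of_ne fun p _ hp => ?_
  by_contra hL
  rw [plaqDatum_of_not_isLetter hL, plaqDatum_of_not_isLetter hL, sub_zero, norm_zero] at hp
  exact hp rfl

/-- **THE WILSON DATUM GAP IN STAPLE CURRENCY**: `‖wilsonDatum c w u b − wilsonDatum c w u₀ b‖ ≤ |c·w|·stapleDist b u₀ u`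
— no factor `3`, no `N_b`, no link closeness. [folklore] -/
theorem norm_wilsonDatum_sub_le_stapleDist (c w : ℝ) (b : PBond P j) (u₀ u : GaugeField P j SU2) :
    ‖wilsonDatum c w u b - wilsonDatum c w u₀ b‖ ≤ |c * w| * stapleDist b u₀ u := by
  unfold wilsonDatum
  rw [← Finset.sum_sub_distrib, stapleDist_eq_sum_univ, Finset.mul_sum]
  refine (norm_sum_le _ _).trans (Finset.sum_le_sum fun p _ => le_of_eq ?_)
  rw [← smul_sub, norm_smul, Real.norm_eq_abs, abs_neg]

/-- Under δ-closeness of the LINKS on the staple bonds the staple deviation is `≤ N_b·3δ`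
(`T4WilsonSmallFieldNumerics.norm_plaqDatum_sub_le_of_staple`). [folklore] -/
theorem stapleDist_le_of_staple {u₀ u : GaugeField P j SU2} {b : PBond P j} {δ : ℝ} (hδ0 : 0 ≤ δ)
    (hδ : ∀ b', IsStaple b b' → ‖su2Quat (u b') - su2Quat (u₀ b')‖ ≤ δ) :
    stapleDist b u₀ u ≤ (letterCount b : ℝ) * (3 * δ) := by
  unfold stapleDist letterCount
  have h := Finset.sum_le_card_nsmul (Finset.univ.filter (fun p : Plaq P j => IsLetter b p))
    (fun p => ‖plaqDatum u b p - plaqDatum u₀ b p‖) (3 * δ) (fun p _ => norm_plaqDatum_sub_le_of_staple hδ0 hδ p)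
  rwa [nsmul_eq_mul] at h

/-! ## §2  (HYB) The hybrid field's plaquettes from the reference field's -/

/-- For `b ∈ ∂p`: the trace of `p` at the HYBRID field `u with u(b) := u₀ b` differs from its trace at `u₀` by at most
the staple distance `‖plaqDatum u b p − plaqDatum u₀ b p‖`. [folklore] -/
theorem abs_reTr_update_sub_reTr_le {u₀ u : GaugeField P j SU2} {b : PBond P j} {p : Plaq P j} (hL : IsLetter b p) :
    |reTr (GaugeField.plaqHol (Function.update u b (u₀ b)) p) - reTr (GaugeField.plaqHol u₀ p)| ≤
      ‖plaqDatum u b p - plaqDatum u₀ b p‖ := by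
  have h : reTr (GaugeField.plaqHol (Function.update u b (u₀ b)) p) - reTr (GaugeField.plaqHol u₀ p) =
      (su2Quat (u₀ b) * (plaqDatum u b p - plaqDatum u₀ b p)).re := by
    rw [mul_sub, Quaternion.re_sub, re_su2Quat_mul_plaqDatum hL, re_su2Quat_mul_plaqDatum hL,
      Function.update_eq_self]
  rw [h]
  exact abs_re_su2Quat_mul_le _ _

/-- Hence a small field `reTr(u₀(∂p)) ≥ 1 − ε` of the REFERENCE field gives the hybrid field's with
`ε + stapleDist b u₀ u`. [folklore] -/
theorem reTr_update_ge_of_stapleDist {u₀ u : GaugeField P j SU2} {b : PBond P j} {ε : ℝ}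
    (hsf₀ : ∀ p, IsLetter b p → 1 - ε ≤ reTr (GaugeField.plaqHol u₀ p)) :
    ∀ p, IsLetter b p → 1 - (ε + stapleDist b u₀ u) ≤ reTr (GaugeField.plaqHol (Function.update u b (u₀ b)) p) := by
  intro p hL
  have h1 := abs_reTr_update_sub_reTr_le (u₀ := u₀) (u := u) hL
  have h2 := norm_plaqDatum_sub_le_stapleDist b u₀ u p
  have h3 := neg_abs_le (reTr (GaugeField.plaqHol (Function.update u b (u₀ b)) p) - reTr (GaugeField.plaqHol u₀ p))
  linarith [hsf₀ p hL]

/-! ## §3  The corollaries -/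

section Plug

variable {b : PBond P j} {n : ℕ} {u₀ : GaugeField P j SU2} {S : ℝ}

open T4CovarianceResponse (respDom)

/-- **THE DATUM-CURRENCY COROLLARY.**  `T4WilsonSmallFieldNumerics.mem_respDom_of_wilson_smallField_num` with the
link-closeness hypothesis and its budget replaced by the single budget `β·w·stapleDist b u₀ u·(1+ρ+ρ²) ≤ bH·dev u`
in staple currency (no `δ`, no factor `3·N_b`). [folklore] -/
theorem mem_respDom_of_wilson_smallField_datum {ι : Type*} (e : ↥({b} : Finset (PBond P j)) × Fin 3 ≃ Fin n)
    (hS : 0 < S) {S' : ℝ} (hSS' : S < S') (hS'1 : S' ≤ 1) {β w : ℝ} (hβ : 0 ≤ β) (hw : 0 ≤ w)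
    (hhm : Measurable fun U : GaugeField P j SU2 => -β * wilsonAction w U) {C : ℝ}
    (hC : ∀ U, windowDensity {b} u₀ S U * Real.exp (-β * wilsonAction w U) ≤ C) {u : GaugeField P j SU2} {K : ℝ}
    (hK : ∀ y : ↥({b} : Finset (PBond P j)) → SU2,
      |(-β * wilsonAction w (updateFinset u₀ {b} y)) - (-β * wilsonAction w (updateFinset u {b} y))| ≤ K)
    {dev : GaugeField P j SU2 → ℝ} (hdev : 0 ≤ dev u) {ε : ℝ} (hε0 : 0 ≤ ε) (hε8 : ε ≤ 1 / 8)
    (hsf₀ : ∀ p, IsLetter b p → 1 - ε ≤ reTr (GaugeField.plaqHol u₀ p))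
    (hsf₁ : ∀ p, IsLetter b p → 1 - ε ≤ reTr (GaugeField.plaqHol (Function.update u b (u₀ b)) p))
    {ρ : ℝ} (hρ : 0 ≤ ρ) (hρ4 : ρ ≤ 1 / 4) (hnS : (n : ℝ) * S' ^ 2 ≤ ρ ^ 2) {bH : ℝ}
    (hgapD : β * w * stapleDist b u₀ u * (1 + ρ + ρ ^ 2) ≤ bH * dev u)
    {B : (↥({b} : Finset (PBond P j)) → SU2) → ι → ℝ} {T : Finset ι} (hBm : ∀ i ∈ T, Measurable fun y => B y i)
    {L : ℝ}
    (hBg : ∀ i ∈ T, ∃ g : (Fin n → ℝ) → ℝ, ContDiff ℝ 1 g ∧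
      (∀ x ∈ cube n S, g x = B (gnoFibreChart {b} u₀ e x) i) ∧
      ∀ x ∈ cube n S, coordGradient g x ⬝ᵥ coordGradient g x ≤ L ^ 2) :
    u ∈ respDom {b} (windowDensity {b} u₀ S) (fun U => -β * wilsonAction w U) u₀ B T dev
      (bH / Real.sqrt (gnoKappa S' + 7 / 25 * (β * w * (2 * ((P.d : ℝ) - 1)))))
      (L / Real.sqrt (gnoKappa S' + 7 / 25 * (β * w * (2 * ((P.d : ℝ) - 1))))) := by
  have hn : n = 3 := card_fibre_eq e
  have hβw : 0 ≤ β * w := mul_nonneg hβ hw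
  have hd1 : (1 : ℝ) ≤ (P.d : ℝ) := by exact_mod_cast P.hd
  have hM : 0 ≤ β * w * (2 * ((P.d : ℝ) - 1)) := mul_nonneg hβw (by linarith)
  have hε1 : ε ≤ 1 := by linarith
  have hρ2 : 2 * ρ ^ 2 ≤ 1 := by nlinarith
  have hNc := letterCount_cast b
  -- the aligned parts
  have hA₀' : β * w * ((letterCount b : ℝ) * (1 - ε)) ≤ (wilsonDatum (-β) w u₀ b * su2Quat (u₀ b)).re :=
    wilson_aligned_ge hβw (g := u₀ b) (by rw [Function.update_eq_self]; exact hsf₀)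
  have hA₁' : β * w * ((letterCount b : ℝ) * (1 - ε)) ≤ (wilsonDatum (-β) w u b * su2Quat (u₀ b)).re :=
    wilson_aligned_ge hβw hsf₁
  have hA0 : 0 ≤ β * w * ((letterCount b : ℝ) * (1 - ε)) :=
    mul_nonneg hβw (mul_nonneg (Nat.cast_nonneg _) (by linarith))
  -- the transverse parts
  have hB₀ := wilson_transverse_le hβw hε0 hε1 (g := u₀ b) (u := u₀) (b := b)
    (by rw [Function.update_eq_self]; exact hsf₀)
  have hB₁ := wilson_transverse_le hβw hε0 hε1 hsf₁
  have hb₀ : 0 ≤ β * w * (letterCount b : ℝ) * Real.sqrt (2 * ε) :=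
    mul_nonneg (mul_nonneg hβw (Nat.cast_nonneg _)) (Real.sqrt_nonneg _)
  -- the numeric modulus
  have hmuM := gnoMu_smallField_ge (M := β * w * (2 * ((P.d : ℝ) - 1))) hM hε8 hρ hρ4
  have e1 : β * w * (2 * ((P.d : ℝ) - 1)) * (1 - ε) = β * w * ((letterCount b : ℝ) * (1 - ε)) := by
    rw [hNc]; ring
  have e2 : β * w * (2 * ((P.d : ℝ) - 1)) * Real.sqrt (2 * ε) = β * w * (letterCount b : ℝ) * Real.sqrt (2 * ε) := by
    rw [hNc]
  rw [e1, e2] at hmuM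
  have hmu₀ := hmuM.trans (gnoMu_mono_left hA₀' hρ2)
  have hmu₁ := hmuM.trans (gnoMu_mono_left hA₁' hρ2)
  -- the window floor makes the modulus positive
  have h3S : 3 * S' ^ 2 ≤ 1 / 16 := by
    have h := hnS
    rw [show (n : ℝ) = 3 by exact_mod_cast hn] at h
    nlinarith
  have hlam : 0 < gnoKappa S' + 7 / 25 * (β * w * (2 * ((P.d : ℝ) - 1))) := by
    have hk := gnoKappa_window_ge h3S
    have h0 : 0 ≤ 7 / 25 * (β * w * (2 * ((P.d : ℝ) - 1))) := mul_nonneg (by norm_num) hM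
    linarith
  -- the datum gap in staple currency
  have hgap : ‖wilsonDatum (-β) w u b - wilsonDatum (-β) w u₀ b‖ * (1 + ρ + ρ ^ 2) ≤ bH * dev u := by
    have h := norm_wilsonDatum_sub_le_stapleDist (-β) w b u₀ u
    rw [show |(-β) * w| = β * w by rw [neg_mul, abs_neg, abs_of_nonneg hβw]] at h
    exact (mul_le_mul_of_nonneg_right h (by positivity)).trans hgapD
  exact mem_respDom_of_gnoChart_linkAffine' e hS hSS' hS'1 hhm hC hK hdev (linkAffine_wilsonAction (-β) w u₀ b)
    (linkAffine_wilsonAction (-β) w u b) (hA0.trans hA₀') (hA0.trans hA₁') hb₀ hB₀ hB₁ hρ hρ2 hnS hmu₀ hmu₁ hlam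
    hgap hBm hBg

/-- **THE CONCRETE COROLLARY.**  The parent plug for the Gibbs exponent `h = fun U => −β * wilsonAction w U` through
the one-link fibre `{b}` with the deviation functional `dev := stapleDist b u₀`, the explicit slope
`β·w·(1+ρ+ρ²)/√λ`, `λ = gnoKappa S' + 7/25·(β·w·2(d−1))`, and field hypotheses on the REFERENCE exterior only:
`reTr(u₀(∂p)) ≥ 1 − ε` on the plaquettes through `b`, and `ε + stapleDist b u₀ u ≤ 1/8`. [folklore] -/
theorem mem_respDom_of_wilson_stapleDist {ι : Type*} (e : ↥({b} : Finset (PBond P j)) × Fin 3 ≃ Fin n)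
    (hS : 0 < S) {S' : ℝ} (hSS' : S < S') (hS'1 : S' ≤ 1) {β w : ℝ} (hβ : 0 ≤ β) (hw : 0 ≤ w)
    (hhm : Measurable fun U : GaugeField P j SU2 => -β * wilsonAction w U) {C : ℝ}
    (hC : ∀ U, windowDensity {b} u₀ S U * Real.exp (-β * wilsonAction w U) ≤ C) {u : GaugeField P j SU2} {K : ℝ}
    (hK : ∀ y : ↥({b} : Finset (PBond P j)) → SU2,
      |(-β * wilsonAction w (updateFinset u₀ {b} y)) - (-β * wilsonAction w (updateFinset u {b} y))| ≤ K)
    {ε : ℝ} (hε0 : 0 ≤ ε) (hεD : ε + stapleDist b u₀ u ≤ 1 / 8)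
    (hsf₀ : ∀ p, IsLetter b p → 1 - ε ≤ reTr (GaugeField.plaqHol u₀ p))
    {ρ : ℝ} (hρ : 0 ≤ ρ) (hρ4 : ρ ≤ 1 / 4) (hnS : (n : ℝ) * S' ^ 2 ≤ ρ ^ 2)
    {B : (↥({b} : Finset (PBond P j)) → SU2) → ι → ℝ} {T : Finset ι} (hBm : ∀ i ∈ T, Measurable fun y => B y i)
    {L : ℝ}
    (hBg : ∀ i ∈ T, ∃ g : (Fin n → ℝ) → ℝ, ContDiff ℝ 1 g ∧
      (∀ x ∈ cube n S, g x = B (gnoFibreChart {b} u₀ e x) i) ∧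
      ∀ x ∈ cube n S, coordGradient g x ⬝ᵥ coordGradient g x ≤ L ^ 2) :
    u ∈ respDom {b} (windowDensity {b} u₀ S) (fun U => -β * wilsonAction w U) u₀ B T (fun U => stapleDist b u₀ U)
      (β * w * (1 + ρ + ρ ^ 2) / Real.sqrt (gnoKappa S' + 7 / 25 * (β * w * (2 * ((P.d : ℝ) - 1)))))
      (L / Real.sqrt (gnoKappa S' + 7 / 25 * (β * w * (2 * ((P.d : ℝ) - 1))))) := by
  have hD := stapleDist_nonneg b u₀ u
  have hsf₀' : ∀ p, IsLetter b p → 1 - (ε + stapleDist b u₀ u) ≤ reTr (GaugeField.plaqHol u₀ p) :=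
    fun p hL => by linarith [hsf₀ p hL]
  exact mem_respDom_of_wilson_smallField_datum e hS hSS' hS'1 hβ hw hhm hC hK (dev := fun U => stapleDist b u₀ U) hD
    (by linarith) hεD hsf₀' (reTr_update_ge_of_stapleDist hsf₀) hρ hρ4 hnS (bH := β * w * (1 + ρ + ρ ^ 2))
    (le_of_eq (by ring)) hBm hBg

/-- NON-VACUITY of the deviation side: the reference exterior itself has `stapleDist b u₀ u₀ = 0`, so for it the
field hypotheses reduce to `reTr(u₀(∂p)) ≥ 7/8` on the plaquettes through `b`. [folklore] -/
example (b : PBond P j) (u₀ : GaugeField P j SU2) {ε : ℝ} (hε : ε ≤ 1 / 8) : ε + stapleDist b u₀ u₀ ≤ 1 / 8 := by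
  rw [stapleDist_self, add_zero]; exact hε

end Plug

end Literature.MathematicalPhysics.QuantumFieldTheory.Balaban1983to89.T4WilsonStapleDeviation

end
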